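import Literature.Geometry.Kaehler.ComplexTorusLefschetzFormParityLatticesDefinite
import HarnessLib

/-!
# The primitive splitting of the integral Hodge lattice: `Hdgᵖ(X, ℤ) ⊇ Hdgᵖ(X, ℤ)_prim ⊕ Hdgᵖ(X, ℤ)_prim^⊥` has finite index dividing
# `|disc Hdgᵖ(X, ℤ)_prim|`, `disc(prim) · disc(prim^⊥) = index² · disc Hdgᵖ(X, ℤ)`, and the Lefschetz part `prim^⊥` has the rank and the
# signature of `Hdgᵖ⁻¹(X, ℤ)`

Layer `Literature/Geometry/Kaehler`, namespace `Literature.Geometry.Kaehler.ComplexTorus`; lane `lit-hodgefound`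
(Track 2 foundations library), seat p09, generation 46, row g46-#9. THEOREMS ONLY (0 definitions); no named fact, net debt 0.
Sequel of g46-#1 (`ComplexTorusIntegralHodgeLatticeSignatureClosedForm`: `B_{2p}∣Hdgᵖ(X, ℤ)` non-degenerate, `rk Hdgᵖ(X, ℤ) = Σ_{i ≤ p} ρ_pr^{(i)}`,
`(b⁺, b⁻)(s·B_{2p}∣Hdgᵖ) = (Σ_{i ≤ p, i even} ρ_pr^{(i)}, Σ_{i odd} ρ_pr^{(i)})`), g45-#2 / g46-#3 (Hodge–Riemann over `ℤ`: `s·B_{2p}` is definite of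
sign `(−1)^p` on the primitive integral Hodge classes) and g45-#1 (`y ⟂ θ ∧ H^{2p−2}(X, ℤ) ⟺ θ^{q+1} ∧ y = 0 ⟺ y` primitive). Over `ℚ` the
Lefschetz decomposition splits the Hodge classes as `Bᵖ(X) = Bᵖ(X)_prim ⊕ L Bᵖ⁻¹(X)`, orthogonally for Voisin's `Q` (Lemma 6.31); over `ℤ`
the two pieces `P = Hdgᵖ(X, ℤ)_prim = Hdgᵖ(X, ℤ) ∩ P^{2p}` and its `B_{2p}`-orthogonal `P^⊥` inside `M = Hdgᵖ(X, ℤ)` (the saturation of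
`θ ∧ Hdgᵖ⁻¹(X, ℤ)`, §3) only span a sublattice of FINITE INDEX, controlled by the discriminants exactly as for `NS(X) ⊇ ℤθ ⊕ NS(X)_prim`
(g44-#1, the case `p = 1` read from the other side) and for `H^{2p}(X, ℤ) ⊇ Hdgᵖ ⊕ T` (g46-#2): Kitaoka's Prop. 5.3.3 and the
discriminant relation `disc Λ · disc Λ^⊥ = [Γ : Λ ⊕ Λ^⊥]² · disc Γ` (Huybrechts (0.2)), available in the tree for any symmetric lattice
form with `det G_Λ ≠ 0` — here `det G_P ≠ 0` because `s·B∣P` is definite.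

## Dictionary

`X = E/Φ(ℤ^ι)` polarised of type `d` (`IsPolarizationType Φ η d`, `g = j + 2`), degree `k = m + 2 = 2p ≥ 2` with `k + q = g`, `γ_q` the
integral minimal class (`hγ`), `B = B_k = ⟨·, γ_q ∧ ·⟩_e` on `Hᵏ(X, ℤ) = integralForms Φ k` (`hB`), `s = sign·(−1)^q`;
`M = Hdgᵖ(X, ℤ)` is the `ℤ`-submodule `AddSubgroup.toIntSubmodule ((integralHodgeClassesIn Φ k p).addSubgroupOf (integralForms Φ k))` of
`Hᵏ(X, ℤ)` (as in g46-#1/#2), `B_M = B.restrict M`; the primitive Hodge lattice is any `P : Submodule ℤ M` with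
`z ∈ P ⟺ z` primitive (hypothesis `hP`; it exists, `exists_submodule_mem_iff_mem_primitiveForms`), `P^⊥ = B_M.orthogonal P`,
`ρ_pr^{(i)} = rk (Hdgⁱ(X, ℤ) ∩ P^{2i})`.

## What is proved

* §1 `IsPolarizationType.det_restrict_primitive_ne_zero` (`det G_P ≠ 0` in every basis; `s·B_M∣P` is positive definite for `p` even, negative
  definite for `p` odd), `IsPolarizationType.finrank_primitive_eq` (`rk P = ρ_pr^{(p)}`).
* §2 **`IsPolarizationType.primitive_splitting`**: `P ⊓ P^⊥ = ⊥`, `rk P + rk P^⊥ = rk M`, `B_M∣P^⊥` non-degenerate, `0 < [M : P ⊕ P^⊥] < ∞`;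
  **`IsPolarizationType.index_primitive_splitting_dvd`**: `[M : P ⊕ P^⊥] ∣ |det G_P|`; **`IsPolarizationType.det_primitive_mul_det_orthogonal_eq`**:
  `det G_P · det G_{P^⊥} = [M : P ⊕ P^⊥]² · det G_M`.
* §3 **`IsPolarizationType.finrank_orthogonal_primitive_eq_sum`** (`rk P^⊥ = Σ_{i < p} ρ_pr^{(i)} = rk Hdgᵖ⁻¹(X, ℤ)`),
  **`IsPolarizationType.sigPos_sigNeg_orthogonal_primitive`** (`(b⁺, b⁻)(s·B_M∣P^⊥) = (Σ_{i < p, i even} ρ_pr^{(i)}, Σ_{i < p, i odd} ρ_pr^{(i)})` — the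
  signature of `s·B_{2p−2}∣Hdgᵖ⁻¹(X, ℤ)`), `IsPolarizationType.mem_orthogonal_primitive_of_eq_wedge_ofRealForm` (**`θ ∧ H^{2p−2}(X, ℤ) ∩ Hdgᵖ(X, ℤ) ⊆ P^⊥`**:
  the Lefschetz classes are orthogonal to the primitive ones, Lemma 6.31 over `ℤ`).

## The sources, verbatim (held copies)

* C. Voisin, *Hodge Theory and Complex Algebraic Geometry I* (CUP 2002), held `book:voisin2002-hodge-theory-complex-algebraic-geometry-i`, §6.3.2
  Lemma 6.31 (PDF p. 128: "The Lefschetz decomposition … is an orthogonal decomposition for `H_k`"), Thm. 6.32 and (6.12); §6.2.3 Rem. 6.27;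
  §7.1.2 (PDF p. 134).
* Y. Kitaoka, *Arithmetic of Quadratic Forms* (CUP 1993), Ch. 5 Prop. 5.3.3 and its proof (`[N : L ⊥ L^⊥] ∣ d(L)`, `d(N)d(L) = d(L^⊥)(d(L)/[N : L ⊥ L^⊥])²`).
* D. Huybrechts, *Lectures on K3 Surfaces* (CUP 2016), Ch. 14 §0.1 (0.2) (`disc Λ' = disc Λ · (Λ : Λ')²`), §0.2 (orthogonal complements).
* H. Lange, *Abelian Varieties over the Complex Numbers* (Springer 2023), §5.4.1 (5.22)–(5.23) (PDF p. 275: the integral Lefschetz decomposition has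
  finite index), §7.2.2, §7.3.2 (3).

## References

* [cite: VoisinHodgeI2002, §6.3.2 Lemma 6.31, Thm. 6.32 and (6.12) (PDF pp. 128–129); §6.2.3 Rem. 6.27; §7.1.2 (PDF p. 134)]
* [cite: Kitaoka1993, Ch. 5 Prop. 5.3.3 (proof)]
* [cite: Huybrechts2016K3, Ch. 14 §0.1 (0.2), §0.2]
* [cite: Lange2023AbelianVarietiesComplex, §5.4.1 (5.22)–(5.23) (PDF p. 275); §7.2.2; §7.3.2 (3)]
-/

noncomputable section

-- `Module ℂ` / `SMulZeroClass ℂ` synthesis on `E [⋀^Fin k]→L[ℝ] ℂ` (as in `ComplexTorusLefschetzDecomposition`)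
set_option maxSynthPendingDepth 3

open Module Function Complex
open LinearMap (BilinForm)
open Literature.LinearAlgebra.Alternating
open Literature.Analysis.Complex (IsOfTypeAt typeSubmodule)

namespace Literature.Geometry.Kaehler.ComplexTorus

/-! ## §0 Two lattice generalities -/

section Generic

variable {V : Type*} [AddCommGroup V] [Module ℤ V]

/-- An anisotropic bilinear form (`B(x, x) ≠ 0` for `x ≠ 0`) is non-degenerate. [folklore] -/
private theorem nondegenerate_of_forall_apply_self_ne_zero₇₉ (B : BilinForm ℤ V) (h : ∀ x, x ≠ 0 → B x x ≠ 0) :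
    B.Nondegenerate := by
  refine ⟨fun x hx ↦ ?_, fun y hy ↦ ?_⟩
  · by_contra hx0
    exact h x hx0 (hx x)
  · by_contra hy0
    exact h y hy0 (hy y)

/-- `Σ_{i ≤ p, i even} f i = Σ_{i < p, i even} f i + [p even] f p`, and the same for odd. [folklore] -/
private theorem sum_filter_range_succ₇₉ (P : ℕ → Prop) [DecidablePred P] (f : ℕ → ℕ) (p : ℕ) :
    ∑ i ∈ (Finset.range (p + 1)).filter P, f i = (∑ i ∈ (Finset.range p).filter P, f i) + if P p then f p else 0 := by
  rw [Finset.range_add_one, Finset.filter_insert]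
  split_ifs with h
  · rw [Finset.sum_insert (by simp), add_comm]
  · rw [add_zero]

end Generic

/-! ## §1 The primitive Hodge lattice `P ⊆ M = Hdgᵖ(X, ℤ)`: definite, `det G_P ≠ 0`, `rk P = ρ_pr^{(p)}` -/

section Splitting

variable {ι : Type*} [Fintype ι] [DecidableEq ι] {E : Type*} [NormedAddCommGroup E] [NormedSpace ℂ E]
  {Φ : (ι → ℝ) ≃L[ℝ] E} {j n m q p : ℕ} {η : E [⋀^Fin 2]→L[ℝ] ℝ} {d : Fin (j + 2) → ℕ}

omit [Fintype ι] [DecidableEq ι] in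
/-- The primitive integral Hodge classes form a `ℤ`-submodule `P` of `M = Hdgᵖ(X, ℤ)` (the hypothesis `hP` of this file is satisfiable).
[cite: Lange2023AbelianVarietiesComplex, §5.4.1 (5.22) (PDF p. 275)] -/
theorem exists_submodule_mem_iff_mem_primitiveForms (Φ : (ι → ℝ) ≃L[ℝ] E) (η : E [⋀^Fin 2]→L[ℝ] ℝ) (k p : ℕ) :
    ∃ P : Submodule ℤ ↥(AddSubgroup.toIntSubmodule ((integralHodgeClassesIn Φ k p).addSubgroupOf (integralForms Φ k))),
      ∀ z, z ∈ P ↔ (((z : ↥(AddSubgroup.toIntSubmodule ((integralHodgeClassesIn Φ k p).addSubgroupOf (integralForms Φ k)))) :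
        ↥(integralForms Φ k)) : E [⋀^Fin k]→L[ℝ] ℂ) ∈ primitiveForms η k :=
  ⟨{ carrier := {z | (((z : ↥(AddSubgroup.toIntSubmodule ((integralHodgeClassesIn Φ k p).addSubgroupOf (integralForms Φ k)))) :
        ↥(integralForms Φ k)) : E [⋀^Fin k]→L[ℝ] ℂ) ∈ primitiveForms η k}
     add_mem' := fun {a b} ha hb ↦ (primitiveForms η k).add_mem ha hb
     zero_mem' := (primitiveForms η k).zero_mem
     smul_mem' := fun c {z} hz ↦ by
       change (c • (((z : ↥(AddSubgroup.toIntSubmodule ((integralHodgeClassesIn Φ k p).addSubgroupOf (integralForms Φ k)))) :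
         ↥(integralForms Φ k)) : E [⋀^Fin k]→L[ℝ] ℂ)) ∈ primitiveForms η k
       rw [← Int.cast_smul_eq_zsmul ℂ c]
       exact (primitiveForms η k).smul_mem _ hz }, fun _ ↦ Iff.rfl⟩

/-- **`s·B_{2p}` is anisotropic of sign `(−1)^p` on the primitive integral Hodge classes** (Hodge–Riemann over `ℤ`, g45-#2 / g46-#3, read inside
`M = Hdgᵖ(X, ℤ)`): for `z ∈ P`, `z ≠ 0`: `(−1)^p·s·B(z, z) > 0`. [cite: VoisinHodgeI2002, §6.3.2 Thm. 6.32 and (6.12) (PDF pp. 128–129); §7.1.2 (PDF p. 134)] -/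
theorem IsPolarizationType.neg_one_pow_mul_apply_self_pos_of_primitive (hd : IsPolarizationType Φ η d) (hη : IsRiemannForm Φ η)
    (hpk : p + p = m + 2) (hkq : m + 2 + q = j + 2) (hq : q ≤ j + 2) {γ : E [⋀^Fin (2 * q)]→L[ℝ] ℂ}
    (hγ : wedgePow (ofRealForm η) q = ((q.factorial * ∏ i : Fin q, d (Fin.castLE hq i) : ℕ) : ℂ) • γ)
    (e : Fin n ≃ ι) (hn : m + 2 + (2 * q + (m + 2)) = n) {B : BilinForm ℤ ↥(integralForms Φ (m + 2))}
    (hB : ∀ x y : ↥(integralForms Φ (m + 2)),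
      ((B x y : ℤ) : ℂ) = poincarePairing Φ e hn (x : E [⋀^Fin (m + 2)]→L[ℝ] ℂ) (γ.wedge (y : E [⋀^Fin (m + 2)]→L[ℝ] ℂ)))
    {P : Submodule ℤ ↥(AddSubgroup.toIntSubmodule ((integralHodgeClassesIn Φ (m + 2) p).addSubgroupOf (integralForms Φ (m + 2))))}
    (hP : ∀ z, z ∈ P ↔ (((z : ↥(AddSubgroup.toIntSubmodule ((integralHodgeClassesIn Φ (m + 2) p).addSubgroupOf
      (integralForms Φ (m + 2))))) : ↥(integralForms Φ (m + 2))) : E [⋀^Fin (m + 2)]→L[ℝ] ℂ) ∈ primitiveForms η (m + 2))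
    {z : ↥(AddSubgroup.toIntSubmodule ((integralHodgeClassesIn Φ (m + 2) p).addSubgroupOf (integralForms Φ (m + 2))))}
    (hz : z ∈ P) (hz0 : z ≠ 0) :
    0 < (-1) ^ p * (orientationSign Φ e * (-1) ^ q * B (z : ↥(integralForms Φ (m + 2))) (z : ↥(integralForms Φ (m + 2)))) := by
  have hk : Even (m + 2) := ⟨p, hpk.symm⟩
  have hzT : IsOfTypeAt p p ((z : ↥(integralForms Φ (m + 2))) : E [⋀^Fin (m + 2)]→L[ℝ] ℂ) :=
    (mem_toIntSubmodule_integralHodgeClassesIn_iff Φ hpk _).1 z.2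
  have hz0' : (z : ↥(integralForms Φ (m + 2))) ≠ 0 := fun h ↦ hz0 (Subtype.ext h)
  rcases Nat.even_or_odd p with hp | hp
  · rw [hp.neg_one_pow, one_mul]
    exact hd.mul_apply_self_pos_of_mem_posPart hη hk hkq hq hγ e hn hB
      (mem_posPart_of_mem_primitiveForms_of_isOfTypeAt η hpk hp ((hP z).1 hz) hzT) hz0'
  · rw [hp.neg_one_pow, neg_one_mul, neg_pos]
    exact hd.mul_apply_self_neg_of_mem_negPart hη hk hkq hq hγ e hn hB
      (mem_negPart_of_mem_primitiveForms_of_isOfTypeAt η hpk hp ((hP z).1 hz) hzT) hz0'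

/-- **`det G_P ≠ 0`** in every `ℤ`-basis of the primitive Hodge lattice `P = Hdgᵖ(X, ℤ)_prim` (`B_M∣P` is anisotropic, hence non-degenerate),
together with the non-degeneracy of `B_M∣P`. [cite: VoisinHodgeI2002, §6.3.2 Thm. 6.32 (PDF p. 128); §7.1.2 (PDF p. 134)] [cite: Huybrechts2016K3, Ch. 14 §0.1] -/
theorem IsPolarizationType.det_restrict_primitive_ne_zero (hd : IsPolarizationType Φ η d) (hη : IsRiemannForm Φ η)
    (hpk : p + p = m + 2) (hkq : m + 2 + q = j + 2) (hq : q ≤ j + 2) {γ : E [⋀^Fin (2 * q)]→L[ℝ] ℂ}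
    (hγ : wedgePow (ofRealForm η) q = ((q.factorial * ∏ i : Fin q, d (Fin.castLE hq i) : ℕ) : ℂ) • γ)
    (e : Fin n ≃ ι) (hn : m + 2 + (2 * q + (m + 2)) = n) {B : BilinForm ℤ ↥(integralForms Φ (m + 2))}
    (hB : ∀ x y : ↥(integralForms Φ (m + 2)),
      ((B x y : ℤ) : ℂ) = poincarePairing Φ e hn (x : E [⋀^Fin (m + 2)]→L[ℝ] ℂ) (γ.wedge (y : E [⋀^Fin (m + 2)]→L[ℝ] ℂ)))
    {P : Submodule ℤ ↥(AddSubgroup.toIntSubmodule ((integralHodgeClassesIn Φ (m + 2) p).addSubgroupOf (integralForms Φ (m + 2))))}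
    (hP : ∀ z, z ∈ P ↔ (((z : ↥(AddSubgroup.toIntSubmodule ((integralHodgeClassesIn Φ (m + 2) p).addSubgroupOf
      (integralForms Φ (m + 2))))) : ↥(integralForms Φ (m + 2))) : E [⋀^Fin (m + 2)]→L[ℝ] ℂ) ∈ primitiveForms η (m + 2))
    {κ : Type*} [Fintype κ] [DecidableEq κ] (c : Basis κ ℤ ↥P) :
    ((B.restrict (AddSubgroup.toIntSubmodule ((integralHodgeClassesIn Φ (m + 2) p).addSubgroupOf (integralForms Φ (m + 2))))).restrict
        P).Nondegenerate ∧
      (LinearMap.BilinForm.toMatrix c ((B.restrict (AddSubgroup.toIntSubmodule ((integralHodgeClassesIn Φ (m + 2) p).addSubgroupOf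
        (integralForms Φ (m + 2))))).restrict P)).det ≠ 0 := by
  have hnd : ((B.restrict (AddSubgroup.toIntSubmodule ((integralHodgeClassesIn Φ (m + 2) p).addSubgroupOf
      (integralForms Φ (m + 2))))).restrict P).Nondegenerate := by
    refine nondegenerate_of_forall_apply_self_ne_zero₇₉ _ fun w hw0 h0 ↦ ?_
    have hpos := hd.neg_one_pow_mul_apply_self_pos_of_primitive hη hpk hkq hq hγ e hn hB hP (z := (w : ↥P)) w.2
      (fun h ↦ hw0 (Subtype.ext h))
    have h0' : B ((w : ↥P) : ↥(integralForms Φ (m + 2))) ((w : ↥P) : ↥(integralForms Φ (m + 2))) = 0 := h0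
    rw [h0', mul_zero, mul_zero] at hpos
    exact lt_irrefl _ hpos
  exact ⟨hnd, (LinearMap.BilinForm.nondegenerate_iff_det_ne_zero c).1 hnd⟩

omit [Fintype ι] [DecidableEq ι] in
/-- **`rk P = ρ_pr^{(p)} = rk (Hdgᵖ(X, ℤ) ∩ P^{2p})`**: the primitive Hodge lattice inside `M` is the intrinsic lattice of g46-#1's rank formula.
[cite: Lange2023AbelianVarietiesComplex, §5.4.1 (5.22) (PDF p. 275); §7.2.2] -/
theorem finrank_primitive_eq (Φ : (ι → ℝ) ≃L[ℝ] E) (η : E [⋀^Fin 2]→L[ℝ] ℝ) (k p : ℕ)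
    {P : Submodule ℤ ↥(AddSubgroup.toIntSubmodule ((integralHodgeClassesIn Φ k p).addSubgroupOf (integralForms Φ k)))}
    (hP : ∀ z, z ∈ P ↔ (((z : ↥(AddSubgroup.toIntSubmodule ((integralHodgeClassesIn Φ k p).addSubgroupOf
      (integralForms Φ k)))) : ↥(integralForms Φ k)) : E [⋀^Fin k]→L[ℝ] ℂ) ∈ primitiveForms η k) :
    finrank ℤ ↥P = finrank ℤ ↥(integralHodgeClassesIn Φ k p ⊓ (primitiveForms η k).toAddSubgroup) := by
  let eP : ↥P ≃ₗ[ℤ] ↥(AddSubgroup.toIntSubmodule (integralHodgeClassesIn Φ k p ⊓ (primitiveForms η k).toAddSubgroup)) :=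
    { toFun := fun z ↦ ⟨(((z : ↥P) : ↥(AddSubgroup.toIntSubmodule ((integralHodgeClassesIn Φ k p).addSubgroupOf
          (integralForms Φ k)))) : ↥(integralForms Φ k)),
        AddSubgroup.mem_inf.2 ⟨AddSubgroup.mem_addSubgroupOf.1 (z : ↥P).1.2, (hP _).1 z.2⟩⟩
      invFun := fun w ↦ ⟨⟨⟨(w : E [⋀^Fin k]→L[ℝ] ℂ), (AddSubgroup.mem_inf.1 w.2).1.1⟩,
          AddSubgroup.mem_addSubgroupOf.2 (AddSubgroup.mem_inf.1 w.2).1⟩, (hP _).2 (AddSubgroup.mem_inf.1 w.2).2⟩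
      left_inv := fun _ ↦ rfl
      right_inv := fun _ ↦ rfl
      map_add' := fun _ _ ↦ rfl
      map_smul' := fun _ _ ↦ rfl }
  exact eP.finrank_eq

/-! ## §2 The splitting `M ⊇ P ⊕ P^⊥`: disjoint, finite index dividing `|det G_P|`, the discriminant relation -/

/-- The data every statement of §§2–3 consumes: `M` is a finite free `ℤ`-module, `B_M` is symmetric and non-degenerate (g46-#1), and `det G_P ≠ 0`.
[cite: VoisinHodgeI2002, §7.1.2 (PDF p. 134)] [cite: Lange2023AbelianVarietiesComplex, §7.2.2] -/
private theorem core₇₉ (hd : IsPolarizationType Φ η d) (hη : IsRiemannForm Φ η)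
    (hpk : p + p = m + 2) (hkq : m + 2 + q = j + 2) (hq : q ≤ j + 2) {γ : E [⋀^Fin (2 * q)]→L[ℝ] ℂ}
    (hγ : wedgePow (ofRealForm η) q = ((q.factorial * ∏ i : Fin q, d (Fin.castLE hq i) : ℕ) : ℂ) • γ)
    (e : Fin n ≃ ι) (hn : m + 2 + (2 * q + (m + 2)) = n) {B : BilinForm ℤ ↥(integralForms Φ (m + 2))}
    (hB : ∀ x y : ↥(integralForms Φ (m + 2)),
      ((B x y : ℤ) : ℂ) = poincarePairing Φ e hn (x : E [⋀^Fin (m + 2)]→L[ℝ] ℂ) (γ.wedge (y : E [⋀^Fin (m + 2)]→L[ℝ] ℂ)))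
    {P : Submodule ℤ ↥(AddSubgroup.toIntSubmodule ((integralHodgeClassesIn Φ (m + 2) p).addSubgroupOf (integralForms Φ (m + 2))))}
    (hP : ∀ z, z ∈ P ↔ (((z : ↥(AddSubgroup.toIntSubmodule ((integralHodgeClassesIn Φ (m + 2) p).addSubgroupOf (integralForms Φ (m + 2))))) : ↥(integralForms Φ (m + 2))) : E [⋀^Fin (m + 2)]→L[ℝ] ℂ) ∈ primitiveForms η (m + 2)) :
    ∃ (r r' : ℕ) (_ : Basis (Fin r) ℤ ↥(AddSubgroup.toIntSubmodule ((integralHodgeClassesIn Φ (m + 2) p).addSubgroupOf (integralForms Φ (m + 2))))) (c : Basis (Fin r') ℤ ↥P),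
      Module.Finite ℤ ↥(AddSubgroup.toIntSubmodule ((integralHodgeClassesIn Φ (m + 2) p).addSubgroupOf (integralForms Φ (m + 2)))) ∧ Module.Free ℤ ↥(AddSubgroup.toIntSubmodule ((integralHodgeClassesIn Φ (m + 2) p).addSubgroupOf (integralForms Φ (m + 2)))) ∧ (B.restrict (AddSubgroup.toIntSubmodule ((integralHodgeClassesIn Φ (m + 2) p).addSubgroupOf (integralForms Φ (m + 2))))).IsSymm ∧ (B.restrict (AddSubgroup.toIntSubmodule ((integralHodgeClassesIn Φ (m + 2) p).addSubgroupOf (integralForms Φ (m + 2))))).Nondegenerate ∧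
      (LinearMap.BilinForm.toMatrix c ((B.restrict (AddSubgroup.toIntSubmodule ((integralHodgeClassesIn Φ (m + 2) p).addSubgroupOf (integralForms Φ (m + 2))))).restrict P)).det ≠ 0 := by
  classical
  letI : LinearOrder ι := linearOrderOfOrientation e
  let bK : Basis {w : Fin (m + 2) → ι // StrictMono w} ℤ ↥(integralForms Φ (m + 2)) := intLatMonomialBasis Φ (m + 2)
  -- `have` + projections (not `obtain`): `rcases` would abstract the `Sigma` term over the (large) goal
  have sb := Submodule.basisOfPid bK (AddSubgroup.toIntSubmodule ((integralHodgeClassesIn Φ (m + 2) p).addSubgroupOf (integralForms Φ (m + 2))))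
  haveI : Module.Finite ℤ ↥(AddSubgroup.toIntSubmodule ((integralHodgeClassesIn Φ (m + 2) p).addSubgroupOf (integralForms Φ (m + 2)))) := Module.Finite.of_basis sb.2
  haveI : Module.Free ℤ ↥(AddSubgroup.toIntSubmodule ((integralHodgeClassesIn Φ (m + 2) p).addSubgroupOf (integralForms Φ (m + 2)))) := Module.Free.of_basis sb.2
  have sc := Submodule.basisOfPid sb.2 P
  have hBs : B.IsSymm := hd.isSymm_of_eq_poincarePairing_wedge_of_even hη ⟨p, hpk.symm⟩ hkq hq hγ e hn hB
  have h4 := hd.nondegenerate_finrank_sigPos_sigNeg_integralHodgeClassesIn_of_eq_poincarePairing_wedge hη hpk hkq hq hγ e hn hB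
  have hdet := (hd.det_restrict_primitive_ne_zero hη hpk hkq hq hγ e hn hB hP sc.2).2
  exact ⟨sb.1, sc.1, sb.2, sc.2, inferInstance, inferInstance, hBs.restrict _, h4.1, hdet⟩

/-- **THE PRIMITIVE SPLITTING OF `Hdgᵖ(X, ℤ)`**: `P ∩ P^⊥ = 0`, `rk P + rk P^⊥ = rk Hdgᵖ(X, ℤ)`, `B∣P^⊥` is non-degenerate, and `P ⊕ P^⊥` has FINITE
(positive) INDEX in `Hdgᵖ(X, ℤ)` — the integral Lefschetz decomposition of the Hodge lattice into its primitive part and the Lefschetz part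
holds up to finite index (Lange (5.22): "a decomposition of finite index"; Voisin Lemma 6.31: orthogonal). [cite: Lange2023AbelianVarietiesComplex, §5.4.1 (5.22) (PDF p. 275); §7.3.2 (3)] [cite: VoisinHodgeI2002, §6.3.2 Lemma 6.31 (PDF p. 128)] [cite: Kitaoka1993, Ch. 5 Prop. 5.3.3 (proof)] [cite: Huybrechts2016K3, Ch. 14 §0.2] -/
theorem IsPolarizationType.primitive_splitting (hd : IsPolarizationType Φ η d) (hη : IsRiemannForm Φ η)
    (hpk : p + p = m + 2) (hkq : m + 2 + q = j + 2) (hq : q ≤ j + 2) {γ : E [⋀^Fin (2 * q)]→L[ℝ] ℂ}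
    (hγ : wedgePow (ofRealForm η) q = ((q.factorial * ∏ i : Fin q, d (Fin.castLE hq i) : ℕ) : ℂ) • γ)
    (e : Fin n ≃ ι) (hn : m + 2 + (2 * q + (m + 2)) = n) {B : BilinForm ℤ ↥(integralForms Φ (m + 2))}
    (hB : ∀ x y : ↥(integralForms Φ (m + 2)),
      ((B x y : ℤ) : ℂ) = poincarePairing Φ e hn (x : E [⋀^Fin (m + 2)]→L[ℝ] ℂ) (γ.wedge (y : E [⋀^Fin (m + 2)]→L[ℝ] ℂ)))
    {P : Submodule ℤ ↥(AddSubgroup.toIntSubmodule ((integralHodgeClassesIn Φ (m + 2) p).addSubgroupOf (integralForms Φ (m + 2))))}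
    (hP : ∀ z, z ∈ P ↔ (((z : ↥(AddSubgroup.toIntSubmodule ((integralHodgeClassesIn Φ (m + 2) p).addSubgroupOf (integralForms Φ (m + 2))))) : ↥(integralForms Φ (m + 2))) : E [⋀^Fin (m + 2)]→L[ℝ] ℂ) ∈ primitiveForms η (m + 2)) :
    P ⊓ (B.restrict (AddSubgroup.toIntSubmodule ((integralHodgeClassesIn Φ (m + 2) p).addSubgroupOf (integralForms Φ (m + 2))))).orthogonal P = ⊥ ∧
      finrank ℤ ↥P + finrank ℤ ↥((B.restrict (AddSubgroup.toIntSubmodule ((integralHodgeClassesIn Φ (m + 2) p).addSubgroupOf (integralForms Φ (m + 2))))).orthogonal P) = finrank ℤ ↥(AddSubgroup.toIntSubmodule ((integralHodgeClassesIn Φ (m + 2) p).addSubgroupOf (integralForms Φ (m + 2)))) ∧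
      ((B.restrict (AddSubgroup.toIntSubmodule ((integralHodgeClassesIn Φ (m + 2) p).addSubgroupOf (integralForms Φ (m + 2))))).restrict ((B.restrict (AddSubgroup.toIntSubmodule ((integralHodgeClassesIn Φ (m + 2) p).addSubgroupOf (integralForms Φ (m + 2))))).orthogonal P)).Nondegenerate ∧
      0 < (P ⊔ (B.restrict (AddSubgroup.toIntSubmodule ((integralHodgeClassesIn Φ (m + 2) p).addSubgroupOf (integralForms Φ (m + 2))))).orthogonal P).toAddSubgroup.index := by
  have Hc := core₇₉ hd hη hpk hkq hq hγ e hn hB hP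
  obtain ⟨r, r', bM, c, hfin, hfree, hsymm, hMn, hdet⟩ := Hc
  haveI := hfin
  haveI := hfree
  have hPn := (hd.det_restrict_primitive_ne_zero hη hpk hkq hq hγ e hn hB hP c).1
  exact ⟨inf_orthogonal_eq_bot_of_det_ne_zero _ P c hdet,
    LinearMap.BilinForm.finrank_add_finrank_orthogonal_of_nondegenerate _ P hsymm hPn,
    nondegenerate_restrict_orthogonal_of_det_ne_zero _ hsymm hMn P c hdet,
    Literature.Topology.FourManifolds.index_sup_orthogonal_pos _ P hsymm c hdet⟩

/-- **`[Hdgᵖ(X, ℤ) : P ⊕ P^⊥] ∣ |det G_P|`** for every `ℤ`-basis `c` of the primitive Hodge lattice `P` (Kitaoka: `M/(P ⊥ P^⊥) ↪ P♯/P`), with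
`det G_P ≠ 0`. [cite: Kitaoka1993, Ch. 5 Prop. 5.3.3 (proof)] [cite: Huybrechts2016K3, Ch. 14 §0.1–§0.2] -/
theorem IsPolarizationType.index_primitive_splitting_dvd (hd : IsPolarizationType Φ η d) (hη : IsRiemannForm Φ η)
    (hpk : p + p = m + 2) (hkq : m + 2 + q = j + 2) (hq : q ≤ j + 2) {γ : E [⋀^Fin (2 * q)]→L[ℝ] ℂ}
    (hγ : wedgePow (ofRealForm η) q = ((q.factorial * ∏ i : Fin q, d (Fin.castLE hq i) : ℕ) : ℂ) • γ)
    (e : Fin n ≃ ι) (hn : m + 2 + (2 * q + (m + 2)) = n) {B : BilinForm ℤ ↥(integralForms Φ (m + 2))}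
    (hB : ∀ x y : ↥(integralForms Φ (m + 2)),
      ((B x y : ℤ) : ℂ) = poincarePairing Φ e hn (x : E [⋀^Fin (m + 2)]→L[ℝ] ℂ) (γ.wedge (y : E [⋀^Fin (m + 2)]→L[ℝ] ℂ)))
    {P : Submodule ℤ ↥(AddSubgroup.toIntSubmodule ((integralHodgeClassesIn Φ (m + 2) p).addSubgroupOf (integralForms Φ (m + 2))))}
    (hP : ∀ z, z ∈ P ↔ (((z : ↥(AddSubgroup.toIntSubmodule ((integralHodgeClassesIn Φ (m + 2) p).addSubgroupOf (integralForms Φ (m + 2))))) : ↥(integralForms Φ (m + 2))) : E [⋀^Fin (m + 2)]→L[ℝ] ℂ) ∈ primitiveForms η (m + 2)) {κ : Type*} [Fintype κ] [DecidableEq κ] (c : Basis κ ℤ ↥P) :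
    (LinearMap.BilinForm.toMatrix c ((B.restrict (AddSubgroup.toIntSubmodule ((integralHodgeClassesIn Φ (m + 2) p).addSubgroupOf (integralForms Φ (m + 2))))).restrict P)).det ≠ 0 ∧
      (P ⊔ (B.restrict (AddSubgroup.toIntSubmodule ((integralHodgeClassesIn Φ (m + 2) p).addSubgroupOf (integralForms Φ (m + 2))))).orthogonal P).toAddSubgroup.index ∣ (LinearMap.BilinForm.toMatrix c ((B.restrict (AddSubgroup.toIntSubmodule ((integralHodgeClassesIn Φ (m + 2) p).addSubgroupOf (integralForms Φ (m + 2))))).restrict P)).det.natAbs := by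
  have Hc := core₇₉ hd hη hpk hkq hq hγ e hn hB hP
  obtain ⟨r, r', bM, _, hfin, hfree, hsymm, _, _⟩ := Hc
  haveI := hfin
  haveI := hfree
  have hdet := (hd.det_restrict_primitive_ne_zero hη hpk hkq hq hγ e hn hB hP c).2
  exact ⟨hdet, Literature.Topology.FourManifolds.index_sup_orthogonal_dvd_natAbs_det _ P hsymm c hdet⟩

/-- **The discriminant relation `det G_P · det G_{P^⊥} = [Hdgᵖ(X, ℤ) : P ⊕ P^⊥]² · det G_{Hdgᵖ(X, ℤ)}`** in any `ℤ`-bases of `Hdgᵖ(X, ℤ)`, `P`, `P^⊥`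
(Huybrechts (0.2) for the finite-index sublattice `P ⊕ P^⊥`; Kitaoka 5.3.3). [cite: Huybrechts2016K3, Ch. 14 §0.1 (0.2), §0.2] [cite: Kitaoka1993, Ch. 5 Prop. 5.3.3 (proof)] -/
theorem IsPolarizationType.det_primitive_mul_det_orthogonal_eq (hd : IsPolarizationType Φ η d) (hη : IsRiemannForm Φ η)
    (hpk : p + p = m + 2) (hkq : m + 2 + q = j + 2) (hq : q ≤ j + 2) {γ : E [⋀^Fin (2 * q)]→L[ℝ] ℂ}
    (hγ : wedgePow (ofRealForm η) q = ((q.factorial * ∏ i : Fin q, d (Fin.castLE hq i) : ℕ) : ℂ) • γ)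
    (e : Fin n ≃ ι) (hn : m + 2 + (2 * q + (m + 2)) = n) {B : BilinForm ℤ ↥(integralForms Φ (m + 2))}
    (hB : ∀ x y : ↥(integralForms Φ (m + 2)),
      ((B x y : ℤ) : ℂ) = poincarePairing Φ e hn (x : E [⋀^Fin (m + 2)]→L[ℝ] ℂ) (γ.wedge (y : E [⋀^Fin (m + 2)]→L[ℝ] ℂ)))
    {P : Submodule ℤ ↥(AddSubgroup.toIntSubmodule ((integralHodgeClassesIn Φ (m + 2) p).addSubgroupOf (integralForms Φ (m + 2))))}
    (hP : ∀ z, z ∈ P ↔ (((z : ↥(AddSubgroup.toIntSubmodule ((integralHodgeClassesIn Φ (m + 2) p).addSubgroupOf (integralForms Φ (m + 2))))) : ↥(integralForms Φ (m + 2))) : E [⋀^Fin (m + 2)]→L[ℝ] ℂ) ∈ primitiveForms η (m + 2)) {ι' κ κ' : Type*} [Fintype ι'] [DecidableEq ι'] [Fintype κ]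
    [DecidableEq κ] [Fintype κ'] [DecidableEq κ'] (bM : Basis ι' ℤ ↥(AddSubgroup.toIntSubmodule ((integralHodgeClassesIn Φ (m + 2) p).addSubgroupOf (integralForms Φ (m + 2))))) (c : Basis κ ℤ ↥P) (bN : Basis κ' ℤ ↥((B.restrict (AddSubgroup.toIntSubmodule ((integralHodgeClassesIn Φ (m + 2) p).addSubgroupOf (integralForms Φ (m + 2))))).orthogonal P)) :
    (LinearMap.BilinForm.toMatrix c ((B.restrict (AddSubgroup.toIntSubmodule ((integralHodgeClassesIn Φ (m + 2) p).addSubgroupOf (integralForms Φ (m + 2))))).restrict P)).det *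
        (LinearMap.BilinForm.toMatrix bN ((B.restrict (AddSubgroup.toIntSubmodule ((integralHodgeClassesIn Φ (m + 2) p).addSubgroupOf (integralForms Φ (m + 2))))).restrict ((B.restrict (AddSubgroup.toIntSubmodule ((integralHodgeClassesIn Φ (m + 2) p).addSubgroupOf (integralForms Φ (m + 2))))).orthogonal P))).det =
      ((P ⊔ (B.restrict (AddSubgroup.toIntSubmodule ((integralHodgeClassesIn Φ (m + 2) p).addSubgroupOf (integralForms Φ (m + 2))))).orthogonal P).toAddSubgroup.index : ℤ) ^ 2 * (LinearMap.BilinForm.toMatrix bM (B.restrict (AddSubgroup.toIntSubmodule ((integralHodgeClassesIn Φ (m + 2) p).addSubgroupOf (integralForms Φ (m + 2)))))).det := by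
  haveI : Module.Finite ℤ ↥(AddSubgroup.toIntSubmodule ((integralHodgeClassesIn Φ (m + 2) p).addSubgroupOf (integralForms Φ (m + 2)))) := Module.Finite.of_basis bM
  haveI : Module.Free ℤ ↥(AddSubgroup.toIntSubmodule ((integralHodgeClassesIn Φ (m + 2) p).addSubgroupOf (integralForms Φ (m + 2)))) := Module.Free.of_basis bM
  have hBs : B.IsSymm := hd.isSymm_of_eq_poincarePairing_wedge_of_even hη ⟨p, hpk.symm⟩ hkq hq hγ e hn hB
  have hdet := (hd.det_restrict_primitive_ne_zero hη hpk hkq hq hγ e hn hB hP c).2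
  exact LinearMap.BilinForm.det_mul_det_orthogonal_eq_index_sq_mul_of_det_ne_zero _ P (hBs.restrict _) bM c bN hdet

/-- **`|det G_{P^⊥}| ∣ |det G_{Hdgᵖ(X, ℤ)}| · |det G_P|`** (Kitaoka's Prop. 5.3.3 for the primitive Hodge lattice).
[cite: Kitaoka1993, Ch. 5 Prop. 5.3.3] -/
theorem IsPolarizationType.natAbs_det_orthogonal_primitive_dvd (hd : IsPolarizationType Φ η d) (hη : IsRiemannForm Φ η)
    (hpk : p + p = m + 2) (hkq : m + 2 + q = j + 2) (hq : q ≤ j + 2) {γ : E [⋀^Fin (2 * q)]→L[ℝ] ℂ}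
    (hγ : wedgePow (ofRealForm η) q = ((q.factorial * ∏ i : Fin q, d (Fin.castLE hq i) : ℕ) : ℂ) • γ)
    (e : Fin n ≃ ι) (hn : m + 2 + (2 * q + (m + 2)) = n) {B : BilinForm ℤ ↥(integralForms Φ (m + 2))}
    (hB : ∀ x y : ↥(integralForms Φ (m + 2)),
      ((B x y : ℤ) : ℂ) = poincarePairing Φ e hn (x : E [⋀^Fin (m + 2)]→L[ℝ] ℂ) (γ.wedge (y : E [⋀^Fin (m + 2)]→L[ℝ] ℂ)))
    {P : Submodule ℤ ↥(AddSubgroup.toIntSubmodule ((integralHodgeClassesIn Φ (m + 2) p).addSubgroupOf (integralForms Φ (m + 2))))}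
    (hP : ∀ z, z ∈ P ↔ (((z : ↥(AddSubgroup.toIntSubmodule ((integralHodgeClassesIn Φ (m + 2) p).addSubgroupOf (integralForms Φ (m + 2))))) : ↥(integralForms Φ (m + 2))) : E [⋀^Fin (m + 2)]→L[ℝ] ℂ) ∈ primitiveForms η (m + 2)) {ι' κ κ' : Type*} [Fintype ι'] [DecidableEq ι'] [Fintype κ]
    [DecidableEq κ] [Fintype κ'] [DecidableEq κ'] (bM : Basis ι' ℤ ↥(AddSubgroup.toIntSubmodule ((integralHodgeClassesIn Φ (m + 2) p).addSubgroupOf (integralForms Φ (m + 2))))) (c : Basis κ ℤ ↥P) (bN : Basis κ' ℤ ↥((B.restrict (AddSubgroup.toIntSubmodule ((integralHodgeClassesIn Φ (m + 2) p).addSubgroupOf (integralForms Φ (m + 2))))).orthogonal P)) :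
    (LinearMap.BilinForm.toMatrix bN ((B.restrict (AddSubgroup.toIntSubmodule ((integralHodgeClassesIn Φ (m + 2) p).addSubgroupOf (integralForms Φ (m + 2))))).restrict ((B.restrict (AddSubgroup.toIntSubmodule ((integralHodgeClassesIn Φ (m + 2) p).addSubgroupOf (integralForms Φ (m + 2))))).orthogonal P))).det.natAbs ∣
      (LinearMap.BilinForm.toMatrix bM (B.restrict (AddSubgroup.toIntSubmodule ((integralHodgeClassesIn Φ (m + 2) p).addSubgroupOf (integralForms Φ (m + 2)))))).det.natAbs * (LinearMap.BilinForm.toMatrix c ((B.restrict (AddSubgroup.toIntSubmodule ((integralHodgeClassesIn Φ (m + 2) p).addSubgroupOf (integralForms Φ (m + 2))))).restrict P)).det.natAbs := by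
  haveI : Module.Finite ℤ ↥(AddSubgroup.toIntSubmodule ((integralHodgeClassesIn Φ (m + 2) p).addSubgroupOf (integralForms Φ (m + 2)))) := Module.Finite.of_basis bM
  haveI : Module.Free ℤ ↥(AddSubgroup.toIntSubmodule ((integralHodgeClassesIn Φ (m + 2) p).addSubgroupOf (integralForms Φ (m + 2)))) := Module.Free.of_basis bM
  have hBs : B.IsSymm := hd.isSymm_of_eq_poincarePairing_wedge_of_even hη ⟨p, hpk.symm⟩ hkq hq hγ e hn hB
  have hdet := (hd.det_restrict_primitive_ne_zero hη hpk hkq hq hγ e hn hB hP c).2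
  exact Literature.Topology.FourManifolds.natAbs_det_restrict_orthogonal_dvd _ P bM c bN (hBs.restrict _) hdet

/-! ## §3 The Lefschetz part `P^⊥`: rank and signature of `Hdgᵖ⁻¹(X, ℤ)`; it contains `θ ∧ H^{2p−2}(X, ℤ) ∩ Hdgᵖ(X, ℤ)` -/

/-- **`rk P^⊥ = Σ_{i < p} ρ_pr^{(i)}`** (`rk Hdgᵖ(X, ℤ) = Σ_{i ≤ p} ρ_pr^{(i)}`, `rk P = ρ_pr^{(p)}`, `rk P + rk P^⊥ = rk Hdgᵖ`).
[cite: Lange2023AbelianVarietiesComplex, §5.4.1 (5.22) (PDF p. 275); §7.3.2 (3)] [cite: VoisinHodgeI2002, §6.2.3 Rem. 6.27] -/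
theorem IsPolarizationType.finrank_orthogonal_primitive_eq_sum (hd : IsPolarizationType Φ η d) (hη : IsRiemannForm Φ η)
    (hpk : p + p = m + 2) (hkq : m + 2 + q = j + 2) (hq : q ≤ j + 2) {γ : E [⋀^Fin (2 * q)]→L[ℝ] ℂ}
    (hγ : wedgePow (ofRealForm η) q = ((q.factorial * ∏ i : Fin q, d (Fin.castLE hq i) : ℕ) : ℂ) • γ)
    (e : Fin n ≃ ι) (hn : m + 2 + (2 * q + (m + 2)) = n) {B : BilinForm ℤ ↥(integralForms Φ (m + 2))}
    (hB : ∀ x y : ↥(integralForms Φ (m + 2)),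
      ((B x y : ℤ) : ℂ) = poincarePairing Φ e hn (x : E [⋀^Fin (m + 2)]→L[ℝ] ℂ) (γ.wedge (y : E [⋀^Fin (m + 2)]→L[ℝ] ℂ)))
    {P : Submodule ℤ ↥(AddSubgroup.toIntSubmodule ((integralHodgeClassesIn Φ (m + 2) p).addSubgroupOf (integralForms Φ (m + 2))))}
    (hP : ∀ z, z ∈ P ↔ (((z : ↥(AddSubgroup.toIntSubmodule ((integralHodgeClassesIn Φ (m + 2) p).addSubgroupOf (integralForms Φ (m + 2))))) : ↥(integralForms Φ (m + 2))) : E [⋀^Fin (m + 2)]→L[ℝ] ℂ) ∈ primitiveForms η (m + 2)) :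
    finrank ℤ ↥((B.restrict (AddSubgroup.toIntSubmodule ((integralHodgeClassesIn Φ (m + 2) p).addSubgroupOf (integralForms Φ (m + 2))))).orthogonal P) =
      ∑ i ∈ Finset.range p, finrank ℤ ↥(integralHodgeClassesIn Φ (2 * i) i ⊓ (primitiveForms η (2 * i)).toAddSubgroup) := by
  have Hs := hd.primitive_splitting hη hpk hkq hq hγ e hn hB hP
  obtain ⟨_, hrk, _, _⟩ := Hs
  rw [finrank_primitive_eq Φ η (m + 2) p hP, finrank_toIntSubmodule_addSubgroupOf_integralHodgeClassesIn,
    hd.finrank_integralHodgeClassesIn_eq_sum hη hpk (by omega), Finset.sum_range_succ,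
    finrank_integralHodgeClassesIn_inf_primitiveForms_congr Φ η (show 2 * p = m + 2 by omega) p] at hrk
  omega

/-- **`rk P^⊥ = rk Hdgᵖ⁻¹(X, ℤ)`** (`p − 1 = p₁`, `2p₁ = m`): the Lefschetz part of `Hdgᵖ(X, ℤ)` has the rank of the previous Hodge lattice, of
which `θ ∧ Hdgᵖ⁻¹(X, ℤ)` is a finite-index image (hard Lefschetz). [cite: Lange2023AbelianVarietiesComplex, §7.3.2 (1), (3); §5.4.1 (5.22)] -/
theorem IsPolarizationType.finrank_orthogonal_primitive_eq_finrank_integralHodgeClassesIn (hd : IsPolarizationType Φ η d) (hη : IsRiemannForm Φ η)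
    (hpk : p + p = m + 2) (hkq : m + 2 + q = j + 2) (hq : q ≤ j + 2) {γ : E [⋀^Fin (2 * q)]→L[ℝ] ℂ}
    (hγ : wedgePow (ofRealForm η) q = ((q.factorial * ∏ i : Fin q, d (Fin.castLE hq i) : ℕ) : ℂ) • γ)
    (e : Fin n ≃ ι) (hn : m + 2 + (2 * q + (m + 2)) = n) {B : BilinForm ℤ ↥(integralForms Φ (m + 2))}
    (hB : ∀ x y : ↥(integralForms Φ (m + 2)),
      ((B x y : ℤ) : ℂ) = poincarePairing Φ e hn (x : E [⋀^Fin (m + 2)]→L[ℝ] ℂ) (γ.wedge (y : E [⋀^Fin (m + 2)]→L[ℝ] ℂ)))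
    {P : Submodule ℤ ↥(AddSubgroup.toIntSubmodule ((integralHodgeClassesIn Φ (m + 2) p).addSubgroupOf (integralForms Φ (m + 2))))}
    (hP : ∀ z, z ∈ P ↔ (((z : ↥(AddSubgroup.toIntSubmodule ((integralHodgeClassesIn Φ (m + 2) p).addSubgroupOf (integralForms Φ (m + 2))))) : ↥(integralForms Φ (m + 2))) : E [⋀^Fin (m + 2)]→L[ℝ] ℂ) ∈ primitiveForms η (m + 2)) {p₁ : ℕ} (hp₁ : p₁ + p₁ = m) :
    finrank ℤ ↥((B.restrict (AddSubgroup.toIntSubmodule ((integralHodgeClassesIn Φ (m + 2) p).addSubgroupOf (integralForms Φ (m + 2))))).orthogonal P) = finrank ℤ ↥(integralHodgeClassesIn Φ m p₁) := by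
  rw [hd.finrank_orthogonal_primitive_eq_sum hη hpk hkq hq hγ e hn hB hP, hd.finrank_integralHodgeClassesIn_eq_sum hη hp₁ (by omega),
    show p = p₁ + 1 by omega]

set_option maxHeartbeats 4000000 in
/-- **The signature of the Lefschetz part: `(b⁺, b⁻)(s·B∣P^⊥) = (Σ_{i < p, i even} ρ_pr^{(i)}, Σ_{i < p, i odd} ρ_pr^{(i)})`** — the indices of
`s·B_{2p−2}` on `Hdgᵖ⁻¹(X, ℤ)` (g46-#1), as it must be for a finite-index overlattice of `θ ∧ Hdgᵖ⁻¹(X, ℤ)` carrying `c·B_{2p−2}`: additivity of the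
indices over `P ⊕ P^⊥` (finite index, Serre), `(b⁺, b⁻)(s·B∣P) = (ρ_pr^{(p)}, 0)` or `(0, ρ_pr^{(p)})` by the parity of `p` (Hodge–Riemann over `ℤ`).
[cite: VoisinHodgeI2002, §6.3.2 Lemma 6.31, Thm. 6.32 and (6.12) (PDF pp. 128–129)] [cite: Serre1973, Ch. V §1.3.2 and §1.3.7] [cite: Kitaoka1993, Ch. 5 Prop. 5.3.3 (proof)] -/
theorem IsPolarizationType.sigPos_sigNeg_orthogonal_primitive (hd : IsPolarizationType Φ η d) (hη : IsRiemannForm Φ η)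
    (hpk : p + p = m + 2) (hkq : m + 2 + q = j + 2) (hq : q ≤ j + 2) {γ : E [⋀^Fin (2 * q)]→L[ℝ] ℂ}
    (hγ : wedgePow (ofRealForm η) q = ((q.factorial * ∏ i : Fin q, d (Fin.castLE hq i) : ℕ) : ℂ) • γ)
    (e : Fin n ≃ ι) (hn : m + 2 + (2 * q + (m + 2)) = n) {B : BilinForm ℤ ↥(integralForms Φ (m + 2))}
    (hB : ∀ x y : ↥(integralForms Φ (m + 2)),
      ((B x y : ℤ) : ℂ) = poincarePairing Φ e hn (x : E [⋀^Fin (m + 2)]→L[ℝ] ℂ) (γ.wedge (y : E [⋀^Fin (m + 2)]→L[ℝ] ℂ)))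
    {P : Submodule ℤ ↥(AddSubgroup.toIntSubmodule ((integralHodgeClassesIn Φ (m + 2) p).addSubgroupOf (integralForms Φ (m + 2))))}
    (hP : ∀ z, z ∈ P ↔ (((z : ↥(AddSubgroup.toIntSubmodule ((integralHodgeClassesIn Φ (m + 2) p).addSubgroupOf (integralForms Φ (m + 2))))) : ↥(integralForms Φ (m + 2))) : E [⋀^Fin (m + 2)]→L[ℝ] ℂ) ∈ primitiveForms η (m + 2)) :
    sigPos ((((orientationSign Φ e * (-1) ^ q) • B).restrict (AddSubgroup.toIntSubmodule ((integralHodgeClassesIn Φ (m + 2) p).addSubgroupOf (integralForms Φ (m + 2))))).restrict ((B.restrict (AddSubgroup.toIntSubmodule ((integralHodgeClassesIn Φ (m + 2) p).addSubgroupOf (integralForms Φ (m + 2))))).orthogonal P)).toQuadraticMap =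
        ∑ i ∈ (Finset.range p).filter Even, finrank ℤ ↥(integralHodgeClassesIn Φ (2 * i) i ⊓ (primitiveForms η (2 * i)).toAddSubgroup) ∧
      sigNeg ((((orientationSign Φ e * (-1) ^ q) • B).restrict (AddSubgroup.toIntSubmodule ((integralHodgeClassesIn Φ (m + 2) p).addSubgroupOf (integralForms Φ (m + 2))))).restrict ((B.restrict (AddSubgroup.toIntSubmodule ((integralHodgeClassesIn Φ (m + 2) p).addSubgroupOf (integralForms Φ (m + 2))))).orthogonal P)).toQuadraticMap =
        ∑ i ∈ (Finset.range p).filter Odd, finrank ℤ ↥(integralHodgeClassesIn Φ (2 * i) i ⊓ (primitiveForms η (2 * i)).toAddSubgroup) := by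
  have Hc := core₇₉ hd hη hpk hkq hq hγ e hn hB hP
  obtain ⟨r, r', bM, c, hfin, hfree, hsymm, hMn, hdet⟩ := Hc
  haveI := hfin
  haveI := hfree
  haveI : Module.Finite ℤ ↥P := Module.Finite.of_basis c
  have hs0 : orientationSign Φ e * (-1) ^ q ≠ 0 := by
    rcases orientationSign_mul_neg_one_pow_eq_or (Φ := Φ) e q with h | h <;> rw [h] <;> norm_num
  -- the indices of `s·B_M` (g46-#1)
  have h4 := hd.nondegenerate_finrank_sigPos_sigNeg_integralHodgeClassesIn_of_eq_poincarePairing_wedge hη hpk hkq hq hγ e hn hB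
  have hpos := h4.2.2.1
  have hneg := h4.2.2.2
  -- `((s·B)|M)|N = (s·B_M)|N` definitionally; move to `s • B_M`
  have hresM : ((orientationSign Φ e * (-1) ^ q) • B).restrict (AddSubgroup.toIntSubmodule ((integralHodgeClassesIn Φ (m + 2) p).addSubgroupOf (integralForms Φ (m + 2)))) =
      (orientationSign Φ e * (-1) ^ q) • B.restrict (AddSubgroup.toIntSubmodule ((integralHodgeClassesIn Φ (m + 2) p).addSubgroupOf (integralForms Φ (m + 2)))) := rfl
  rw [hresM] at hpos hneg ⊢
  -- additivity of the indices over the finite-index `P ⊕ P^⊥`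
  have hsymm_s : ((orientationSign Φ e * (-1) ^ q) • B.restrict (AddSubgroup.toIntSubmodule ((integralHodgeClassesIn Φ (m + 2) p).addSubgroupOf (integralForms Φ (m + 2))))).IsSymm := LinearMap.BilinForm.isSymm_smul_of_isSymm _ _ hsymm
  have hdet_s : (LinearMap.BilinForm.toMatrix c (((orientationSign Φ e * (-1) ^ q) • B.restrict (AddSubgroup.toIntSubmodule ((integralHodgeClassesIn Φ (m + 2) p).addSubgroupOf (integralForms Φ (m + 2))))).restrict P)).det ≠ 0 := by
    have h1 : LinearMap.BilinForm.toMatrix c (((orientationSign Φ e * (-1) ^ q) • B.restrict (AddSubgroup.toIntSubmodule ((integralHodgeClassesIn Φ (m + 2) p).addSubgroupOf (integralForms Φ (m + 2))))).restrict P) =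
        (orientationSign Φ e * (-1) ^ q) • LinearMap.BilinForm.toMatrix c ((B.restrict (AddSubgroup.toIntSubmodule ((integralHodgeClassesIn Φ (m + 2) p).addSubgroupOf (integralForms Φ (m + 2))))).restrict P) :=
      (LinearMap.BilinForm.toMatrix c).map_smul (orientationSign Φ e * (-1) ^ q) ((B.restrict (AddSubgroup.toIntSubmodule ((integralHodgeClassesIn Φ (m + 2) p).addSubgroupOf (integralForms Φ (m + 2))))).restrict P)
    rw [h1, Matrix.det_smul]
    exact mul_ne_zero (pow_ne_zero _ hs0) hdet
  have hadd := sigPos_sigNeg_eq_add_restrict_orthogonal_of_det_ne_zero _ hsymm_s P c hdet_s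
  rw [orthogonal_smul_eq_of_ne_zero (B.restrict (AddSubgroup.toIntSubmodule ((integralHodgeClassesIn Φ (m + 2) p).addSubgroupOf (integralForms Φ (m + 2))))) hs0 P, hpos, hneg] at hadd
  -- `rk P = ρ_pr^{(p)}` and the indices of `s·B_M|P` by the parity of `p`
  have hrkP : finrank ℤ ↥P = finrank ℤ ↥(integralHodgeClassesIn Φ (2 * p) p ⊓ (primitiveForms η (2 * p)).toAddSubgroup) := by
    rw [finrank_primitive_eq Φ η (m + 2) p hP, finrank_integralHodgeClassesIn_inf_primitiveForms_congr Φ η (show m + 2 = 2 * p by omega) p]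
  have hk : Even (m + 2) := ⟨p, hpk.symm⟩
  have hwT : ∀ w : ↥P, IsOfTypeAt p p (((w : ↥(AddSubgroup.toIntSubmodule ((integralHodgeClassesIn Φ (m + 2) p).addSubgroupOf (integralForms Φ (m + 2))))) : ↥(integralForms Φ (m + 2))) : E [⋀^Fin (m + 2)]→L[ℝ] ℂ) := fun w ↦
    (mem_toIntSubmodule_integralHodgeClassesIn_iff Φ hpk _).1 (w : ↥(AddSubgroup.toIntSubmodule ((integralHodgeClassesIn Φ (m + 2) p).addSubgroupOf (integralForms Φ (m + 2))))).2
  have hw0' : ∀ w : ↥P, w ≠ 0 → ((w : ↥(AddSubgroup.toIntSubmodule ((integralHodgeClassesIn Φ (m + 2) p).addSubgroupOf (integralForms Φ (m + 2))))) : ↥(integralForms Φ (m + 2))) ≠ 0 := fun w hw0 h ↦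
    hw0 (Subtype.ext (Subtype.ext h))
  -- (elaboration on the doubly nested carrier `↥P`, `P ≤ M ≤ Hᵏ(X, ℤ)`, is heartbeat-heavy: hence the raised limit and the lean tactics)
  refine (Nat.even_or_odd p).elim (fun hp ↦ ?_) (fun hp ↦ ?_)
  · have hPD : (((orientationSign Φ e * (-1) ^ q) • B.restrict (AddSubgroup.toIntSubmodule ((integralHodgeClassesIn Φ (m + 2) p).addSubgroupOf (integralForms Φ (m + 2))))).restrict P).PosDef := by
      rw [LinearMap.BilinForm.posDef_iff]
      intro w hw0
      have h := hd.mul_apply_self_pos_of_mem_posPart hη hk hkq hq hγ e hn hB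
        (mem_posPart_of_mem_primitiveForms_of_isOfTypeAt η hpk hp ((hP _).1 w.2) (hwT w)) (hw0' w hw0)
      change 0 < ((orientationSign Φ e * (-1) ^ q) • B.restrict (AddSubgroup.toIntSubmodule ((integralHodgeClassesIn Φ (m + 2) p).addSubgroupOf (integralForms Φ (m + 2))))) (w : ↥(AddSubgroup.toIntSubmodule ((integralHodgeClassesIn Φ (m + 2) p).addSubgroupOf (integralForms Φ (m + 2))))) (w : ↥(AddSubgroup.toIntSubmodule ((integralHodgeClassesIn Φ (m + 2) p).addSubgroupOf (integralForms Φ (m + 2)))))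
      rw [LinearMap.smul_apply, LinearMap.smul_apply, smul_eq_mul]
      exact h
    have hsig := sigPos_eq_finrank_and_sigNeg_eq_zero_of_posDef _ hPD
    have hse : ∑ i ∈ (Finset.range (p + 1)).filter Even, finrank ℤ ↥(integralHodgeClassesIn Φ (2 * i) i ⊓ (primitiveForms η (2 * i)).toAddSubgroup) = (∑ i ∈ (Finset.range p).filter Even, finrank ℤ ↥(integralHodgeClassesIn Φ (2 * i) i ⊓ (primitiveForms η (2 * i)).toAddSubgroup)) + finrank ℤ ↥(integralHodgeClassesIn Φ (2 * p) p ⊓ (primitiveForms η (2 * p)).toAddSubgroup) := by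
      rw [sum_filter_range_succ₇₉, if_pos hp]
    have hso : ∑ i ∈ (Finset.range (p + 1)).filter Odd, finrank ℤ ↥(integralHodgeClassesIn Φ (2 * i) i ⊓ (primitiveForms η (2 * i)).toAddSubgroup) = ∑ i ∈ (Finset.range p).filter Odd, finrank ℤ ↥(integralHodgeClassesIn Φ (2 * i) i ⊓ (primitiveForms η (2 * i)).toAddSubgroup) := by
      rw [sum_filter_range_succ₇₉, if_neg (Nat.not_odd_iff_even.2 hp), add_zero]
    constructor <;> omega
  · -- odd `p`: `(-s)·B_M|P` is positive definite; `sigPos (−Q) = sigNeg Q`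
    have hPD' : (((-(orientationSign Φ e * (-1) ^ q)) • B.restrict (AddSubgroup.toIntSubmodule ((integralHodgeClassesIn Φ (m + 2) p).addSubgroupOf (integralForms Φ (m + 2))))).restrict P).PosDef := by
      rw [LinearMap.BilinForm.posDef_iff]
      intro w hw0
      have h := hd.mul_apply_self_neg_of_mem_negPart hη hk hkq hq hγ e hn hB
        (mem_negPart_of_mem_primitiveForms_of_isOfTypeAt η hpk hp ((hP _).1 w.2) (hwT w)) (hw0' w hw0)
      change 0 < ((-(orientationSign Φ e * (-1) ^ q)) • B.restrict (AddSubgroup.toIntSubmodule ((integralHodgeClassesIn Φ (m + 2) p).addSubgroupOf (integralForms Φ (m + 2))))) (w : ↥(AddSubgroup.toIntSubmodule ((integralHodgeClassesIn Φ (m + 2) p).addSubgroupOf (integralForms Φ (m + 2))))) (w : ↥(AddSubgroup.toIntSubmodule ((integralHodgeClassesIn Φ (m + 2) p).addSubgroupOf (integralForms Φ (m + 2)))))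
      rw [LinearMap.smul_apply, LinearMap.smul_apply, smul_eq_mul, neg_mul, neg_pos]
      exact h
    have hsig' := sigPos_eq_finrank_and_sigNeg_eq_zero_of_posDef _ hPD'
    have hneg_eq : ((-(orientationSign Φ e * (-1) ^ q)) • B.restrict (AddSubgroup.toIntSubmodule ((integralHodgeClassesIn Φ (m + 2) p).addSubgroupOf (integralForms Φ (m + 2))))).restrict P =
        -(((orientationSign Φ e * (-1) ^ q) • B.restrict (AddSubgroup.toIntSubmodule ((integralHodgeClassesIn Φ (m + 2) p).addSubgroupOf (integralForms Φ (m + 2))))).restrict P) := by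
      rw [neg_smul]
      rfl
    rw [hneg_eq, show (-(((orientationSign Φ e * (-1) ^ q) • B.restrict (AddSubgroup.toIntSubmodule ((integralHodgeClassesIn Φ (m + 2) p).addSubgroupOf (integralForms Φ (m + 2))))).restrict P)).toQuadraticMap =
        -((((orientationSign Φ e * (-1) ^ q) • B.restrict (AddSubgroup.toIntSubmodule ((integralHodgeClassesIn Φ (m + 2) p).addSubgroupOf (integralForms Φ (m + 2))))).restrict P)).toQuadraticMap from rfl, sigPos_neg, sigNeg_neg] at hsig'
    have hsig : sigPos ((((orientationSign Φ e * (-1) ^ q) • B.restrict (AddSubgroup.toIntSubmodule ((integralHodgeClassesIn Φ (m + 2) p).addSubgroupOf (integralForms Φ (m + 2))))).restrict P)).toQuadraticMap = 0 ∧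
        sigNeg ((((orientationSign Φ e * (-1) ^ q) • B.restrict (AddSubgroup.toIntSubmodule ((integralHodgeClassesIn Φ (m + 2) p).addSubgroupOf (integralForms Φ (m + 2))))).restrict P)).toQuadraticMap = finrank ℤ ↥P :=
      ⟨hsig'.2, hsig'.1⟩
    have hse : ∑ i ∈ (Finset.range (p + 1)).filter Even, finrank ℤ ↥(integralHodgeClassesIn Φ (2 * i) i ⊓ (primitiveForms η (2 * i)).toAddSubgroup) = ∑ i ∈ (Finset.range p).filter Even, finrank ℤ ↥(integralHodgeClassesIn Φ (2 * i) i ⊓ (primitiveForms η (2 * i)).toAddSubgroup) := by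
      rw [sum_filter_range_succ₇₉, if_neg (Nat.not_even_iff_odd.2 hp), add_zero]
    have hso : ∑ i ∈ (Finset.range (p + 1)).filter Odd, finrank ℤ ↥(integralHodgeClassesIn Φ (2 * i) i ⊓ (primitiveForms η (2 * i)).toAddSubgroup) = (∑ i ∈ (Finset.range p).filter Odd, finrank ℤ ↥(integralHodgeClassesIn Φ (2 * i) i ⊓ (primitiveForms η (2 * i)).toAddSubgroup)) + finrank ℤ ↥(integralHodgeClassesIn Φ (2 * p) p ⊓ (primitiveForms η (2 * p)).toAddSubgroup) := by
      rw [sum_filter_range_succ₇₉, if_pos hp]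
    constructor <;> omega

/-- **The Lefschetz classes are orthogonal to the primitive ones, over `ℤ`: `θ ∧ H^{2p−2}(X, ℤ) ∩ Hdgᵖ(X, ℤ) ⊆ P^⊥`** — an integral Hodge class of
the form `y ∧ θ` (`y ∈ H^{2p−2}(X, ℤ)`) is `B_{2p}`-orthogonal to every primitive integral Hodge class (`B(z, y ∧ θ) ∼ ∫ θ^{q+1} ∧ z ∧ y = 0` for `z`
primitive of degree `g − q`: Voisin's Lemma 6.31). [cite: VoisinHodgeI2002, §6.3.2 Lemma 6.31 (PDF p. 128); §6.2.3 Rem. 6.27] [cite: Lange2023AbelianVarietiesComplex, §7.3.2 (3)] -/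
theorem IsPolarizationType.mem_orthogonal_primitive_of_eq_wedge_ofRealForm (hd : IsPolarizationType Φ η d) (hη : IsRiemannForm Φ η)
    (hpk : p + p = m + 2) (hkq : m + 2 + q = j + 2) (hq : q ≤ j + 2) {γ : E [⋀^Fin (2 * q)]→L[ℝ] ℂ}
    (hγ : wedgePow (ofRealForm η) q = ((q.factorial * ∏ i : Fin q, d (Fin.castLE hq i) : ℕ) : ℂ) • γ)
    (e : Fin n ≃ ι) (hn : m + 2 + (2 * q + (m + 2)) = n) {B : BilinForm ℤ ↥(integralForms Φ (m + 2))}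
    (hB : ∀ x y : ↥(integralForms Φ (m + 2)),
      ((B x y : ℤ) : ℂ) = poincarePairing Φ e hn (x : E [⋀^Fin (m + 2)]→L[ℝ] ℂ) (γ.wedge (y : E [⋀^Fin (m + 2)]→L[ℝ] ℂ)))
    {P : Submodule ℤ ↥(AddSubgroup.toIntSubmodule ((integralHodgeClassesIn Φ (m + 2) p).addSubgroupOf (integralForms Φ (m + 2))))}
    (hP : ∀ z, z ∈ P ↔ (((z : ↥(AddSubgroup.toIntSubmodule ((integralHodgeClassesIn Φ (m + 2) p).addSubgroupOf (integralForms Φ (m + 2))))) : ↥(integralForms Φ (m + 2))) : E [⋀^Fin (m + 2)]→L[ℝ] ℂ) ∈ primitiveForms η (m + 2))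
    {x : ↥(AddSubgroup.toIntSubmodule ((integralHodgeClassesIn Φ (m + 2) p).addSubgroupOf (integralForms Φ (m + 2))))} {y : ↥(integralForms Φ m)}
    (hxy : ((x : ↥(integralForms Φ (m + 2))) : E [⋀^Fin (m + 2)]→L[ℝ] ℂ) = (y : E [⋀^Fin m]→L[ℝ] ℂ).wedge (ofRealForm η : E [⋀^Fin 2]→L[ℝ] ℂ)) :
    x ∈ (B.restrict (AddSubgroup.toIntSubmodule ((integralHodgeClassesIn Φ (m + 2) p).addSubgroupOf (integralForms Φ (m + 2))))).orthogonal P := by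
  haveI : FiniteDimensional ℝ E := Module.Finite.equiv Φ.toLinearEquiv
  haveI : FiniteDimensional ℂ E := Module.Finite.of_restrictScalars_finite ℝ ℂ E
  have hE : finrank ℝ E = Fintype.card ι := by
    rw [← Φ.toLinearEquiv.finrank_eq, Module.finrank_fintype_fun_eq_card]
  have hg : finrank ℂ E = j + 2 := by
    have h := finrank_real_of_complex E
    rw [hE, hd.card_eq] at h
    omega
  have hBs : B.IsSymm := hd.isSymm_of_eq_poincarePairing_wedge_of_even hη ⟨p, hpk.symm⟩ hkq hq hγ e hn hB
  obtain ⟨L, hL⟩ := exists_submodule_mem_iff_exists_eq_wedge_ofRealForm (Φ := Φ) hη m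
  have hxL : (x : ↥(integralForms Φ (m + 2))) ∈ L := (hL _).2 ⟨y, hxy⟩
  rw [LinearMap.BilinForm.mem_orthogonal_iff]
  intro z hz
  -- `z` primitive ⟹ `θ^{q+1} ∧ z = 0` ⟹ `z ⟂ L`
  have hzP : (((z : ↥(AddSubgroup.toIntSubmodule ((integralHodgeClassesIn Φ (m + 2) p).addSubgroupOf (integralForms Φ (m + 2))))) : ↥(integralForms Φ (m + 2))) : E [⋀^Fin (m + 2)]→L[ℝ] ℂ) ∈ primitiveForms η (m + 2) := (hP z).1 hz
  rw [mem_primitiveForms_iff_of_add_eq η (show m + 2 + q = finrank ℂ E by omega)] at hzP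
  have hzO : ((z : ↥(AddSubgroup.toIntSubmodule ((integralHodgeClassesIn Φ (m + 2) p).addSubgroupOf (integralForms Φ (m + 2))))) : ↥(integralForms Φ (m + 2))) ∈ B.orthogonal L :=
    (hd.mem_orthogonal_lefschetz_iff_of_eq_poincarePairing_wedge hη hq hγ e hn hB hL _).2 hzP
  have h0 : B (x : ↥(integralForms Φ (m + 2))) ((z : ↥(AddSubgroup.toIntSubmodule ((integralHodgeClassesIn Φ (m + 2) p).addSubgroupOf (integralForms Φ (m + 2))))) : ↥(integralForms Φ (m + 2))) = 0 :=
    (LinearMap.BilinForm.mem_orthogonal_iff.1 hzO) _ hxL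
  change B ((z : ↥(AddSubgroup.toIntSubmodule ((integralHodgeClassesIn Φ (m + 2) p).addSubgroupOf (integralForms Φ (m + 2))))) : ↥(integralForms Φ (m + 2))) (x : ↥(integralForms Φ (m + 2))) = 0
  rw [← hBs.eq, h0]

end Splitting

end Literature.Geometry.Kaehler.ComplexTorus

end
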